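import Summits.Ventures.DiscreteObjects.Hadamard.ConferenceRoute668
import Summits.Ventures.DiscreteObjects.Hadamard.ConferenceSymmetrization
import Summits.Ventures.DiscreteObjects.Hadamard.ConferenceGraph333

/-!
# The order-334 routes to H(668), assembled (kernel): `srg(333,166,82,83) ⇒ C(334) ⇒ symmetric C(334) ⇒ SYMMETRIC H(668)`

Framing: lottery ticket; floor = certified bounds/negative ranges.  Cell pub-namedobj (venture DiscreteObjects),
target (H), hadamard gen 27.  Composition of the gen-27 files `ConferenceRoute668` (doubling), `ConferenceSymmetrization`
(Delsarte–Goethals–Seidel) and `ConferenceGraph333` (Seidel matrices of conference graphs):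
* `symm_double_transpose` — the doubled matrix `[[S + I, S − I], [Sᵀ − I, −Sᵀ − I]]` of a symmetric `S` is symmetric;
* **`symmHadamard668_of_conference334`** — ANY conference matrix of order `334` yields a SYMMETRIC Hadamard matrix of order
  `668` (sign it to a symmetric conference matrix by DGS, then double): so `C(334)` would settle two open named objects,
  `H(668)` and a symmetric `H(668)` (Balonin–Seberry's propus list has `4·167` unresolved);
* **`hadamard668_of_srg333`**, **`symmHadamard668_of_srg333`** — a conference graph `srg(333, 166, 82, 83)` yields `C(334)` and
  hence a (symmetric) `H(668)`.
WORDS: dictionary (plug-ins about hypothetical objects); `srg(333,166,82,83)`, `C(334)`, `H(668)` all OPEN; no order excluded.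
Ours; no `sorry`.
-/

namespace Summit.Ventures.DiscreteObjects.Hadamard

open Finset BigOperators Matrix

open Literature.Combinatorics.Designs.GoethalsSeidel (IsHadamardMatrix)

variable {ι : Type*} [Fintype ι] [DecidableEq ι]

omit [Fintype ι] in
/-- the conference doubling of a SYMMETRIC matrix is symmetric. -/
theorem symm_double_transpose (S : Matrix ι ι ℤ) (hS : Sᵀ = S) :
    (Matrix.fromBlocks (S + 1) (S - 1) (Sᵀ - 1) (-Sᵀ - 1))ᵀ = Matrix.fromBlocks (S + 1) (S - 1) (Sᵀ - 1) (-Sᵀ - 1) := by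
  rw [Matrix.fromBlocks_transpose, hS]
  simp [Matrix.transpose_add, Matrix.transpose_sub, Matrix.transpose_neg, Matrix.transpose_one, hS]

/-- **Every conference matrix of order `334` yields a SYMMETRIC Hadamard matrix of order `668`**: DGS-sign `C` to a symmetric
conference matrix `S = (d_i C_ij e_j)` (`conference334_symm_signing`), then double it (`conference_double_isHadamard`). -/
theorem symmHadamard668_of_conference334 (hι : Fintype.card ι = 334) {C : Matrix ι ι ℤ} (hdiag : ∀ i, C i i = 0)
    (hoff : ∀ i j, i ≠ j → C i j = 1 ∨ C i j = -1) (hC : C * Cᵀ = (333 : ℤ) • (1 : Matrix ι ι ℤ)) :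
    ∃ H : Matrix (ι ⊕ ι) (ι ⊕ ι) ℤ, IsHadamardMatrix H ∧ Hᵀ = H ∧ Fintype.card (ι ⊕ ι) = 668 := by
  obtain ⟨d, e, -, -, hsym, hSd, hSo, hSg⟩ := conference334_symm_signing hι hdiag hoff hC
  set S : Matrix ι ι ℤ := Matrix.of fun i j => d i * C i j * e j with hSdef
  have hST : Sᵀ = S := by ext i j; rw [Matrix.transpose_apply]; exact (hsym i j).symm
  refine ⟨_, (hadamard668_of_conference334 hι S hSd hSo hSg).1, symm_double_transpose S hST, by rw [Fintype.card_sum, hι]⟩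

/-- **A conference graph `srg(333, 166, 82, 83)` yields a Hadamard matrix of order `668`** (through its bordered Seidel matrix,
a symmetric `C(334)`, and the doubling). -/
theorem hadamard668_of_srg333 {V : Type*} [Fintype V] [DecidableEq V] (hV : Fintype.card V = 333) (A : Matrix V V ℤ)
    (h01 : ∀ x y, A x y = 0 ∨ A x y = 1) (hsymm : ∀ x y, A y x = A x y) (hdiag : ∀ x, A x x = 0)
    (hk : ∀ x, ∑ y, A x y = 166) (hsrg : ∀ x y, ∑ z, A x z * A z y = 83 * (1 + (if x = y then 1 else 0)) - A x y) :
    ∃ H : Matrix ((Option V) ⊕ (Option V)) ((Option V) ⊕ (Option V)) ℤ,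
      IsHadamardMatrix H ∧ Hᵀ = H ∧ Fintype.card ((Option V) ⊕ (Option V)) = 668 := by
  obtain ⟨h1, h2, h3, h4, h5⟩ := conference334_of_srg333 hV A h01 hsymm hdiag hk hsrg
  set C : Matrix (Option V) (Option V) ℤ := Matrix.of fun p q => Option.elim p (Option.elim q 0 (fun _ => 1))
      (fun x => Option.elim q 1 (fun y => 1 - (if x = y then 1 else 0) - 2 * A x y)) with hCdef
  have hCT : Cᵀ = C := by ext p q; rw [Matrix.transpose_apply]; exact h3 p q
  exact ⟨_, (hadamard668_of_conference334 h5 C h1 h2 h4).1, symm_double_transpose C hCT,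
    by rw [Fintype.card_sum, h5]⟩

end Summit.Ventures.DiscreteObjects.Hadamard
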